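import Summits.QuantumFields.YangMills.Theorems.BalabanUVNodesK0AxJoinResidual
import Summits.QuantumFields.YangMills.Theorems.BalabanUVNodesK0RecordFormatNamesLemmas5

/-!
# P3 g88 — §7 SKETCH (LENS P3 «weaken the target», after ★★★ №515 (3)): THE TOKEN-FREE DOOR SPLIT INTO ITS (1.21)-LIMIT HALF AND ITS PER-VOLUME
# EVENTUAL-DECAY HALF — the ONE single-volume decaying object the JOIN road needs is the KERNEL `recordPvolAx F a₀ ε₂₉ k (prefixOf gs k) K 0 1`

LANDED VERBATIM (declarations and proofs byte-identical; this one paragraph added) by porter PTC-1 g3 (`ymgap-nodeO-port-PTC-1`, O-8∕O-11 JOIN pen) as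
`Summits/QuantumFields/YangMills/Theorems/BalabanUVNodesK0AxJoinResidualSplit.lean` `--supports stmt-QuantumFields-27238 --as helper` (INTENT-21, nodeO STATUS), on ★ P3 g88's
OFFER of 2026-08-31T05:45:37Z («append §7 to the tree file … or keep it HOME-only — your pen»; landed as its OWN file rather than an append because `…K0AxJoinResidual.lean` is
344 l. and the tree's file cap is 400 l.); AUTHORSHIP = ★ P3 g88 (HOME `pub/ym-nodeO-ideate/nodeO-cover/P3-K0AxJoinResidualSplit-v1.lean` 87e2ccf0da1b475f · 133 l. · 5 thm ·
0 def; farm rc 0 · 0 err · 0 warn · 0 sorry at P3's desk 05:44:39Z, re-checked by PTC-1).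
Cell `ym-nodeO-ideate`, seat ★ P3 g88 (count-neutral sketch at authorship).  Builds on the landed ✓p812183
`Summits/QuantumFields/YangMills/Theorems/BalabanUVNodesK0AxJoinResidual.lean` (e6670f4aaf0a3b3e; §6 the token-free door
`record13SepCoPHInhabitedAx_of_lim_residual_tokFree`) and on DEF∕K0-names lemma ✓`K0RecordFormatNames.recordPlimDecayOnRunsAx_of_pvol`
(`…K0RecordFormatNamesLemmas5.lean` :148: the (1.21) limit letter + the per-volume EVENTUAL (5.10) letter with run-uniform `(C, δ₁)` ⟹ the (5.10) letter for the
LIMIT kernel — decay passes to the pointwise volume limit, `tendsto_pvolOf` + `le_of_tendsto`).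

WHAT THIS ANSWERS (★★★ №515 (3): «K0ᴬ's (K-1) from two-volume differences ALONE? telescoping ⇒ limit exists; decay of the limit still needs one decaying
representative — if not, (α) is load-bearing»).  TYPED ANSWER: the token-free door's hypothesis `∀ F, JoinConclLimR ⊤ F` (conclusion `RecordPolLimitOnRunsAx ∧
RecordPlimDecayOnRunsAx`) follows from TWO halves under the same JOIN antecedents —
* (L-lim) the (1.21) letter `RecordPolLimitOnRunsAx F a₀ ε₂₉ γ` (volume limits of the kernels `recordPvolAx … K` exist along runs) — the half a TWO-VOLUME ∕ Cauchy road can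
  feed (differences of consecutive volumes; ◇ lens-1 road (2), ★ PTB-1 g4; S-wrap-EXEMPT by ★★★ №515 (2));
* (L-dec) the per-volume EVENTUAL (5.10) letter `RecordPvolDecayEvOnRunsAx F a₀ ε₂₉ γ C δ₁` (`…K0RecordFormatNamesDecay.lean` :131): `∀ z, ∀ᶠ K, |recordPvolAx F a₀ ε₂₉ k
  (prefixOf gs k) K 0 1 z| ≤ C·exp(−δ₁·‖z‖₁)` with `(C, δ₁)` uniform along the run — the «one decaying representative» is THIS KERNEL: the second-order kernel in the
  datum `B` of the one-step output functional `ΦfOf (recordTermsAx F a₀ ε₂₉) θ.ρ8` at finite volume (`…K0RecordFormatNamesAx.lean` §20), displacement `z ∈ ℤ⁴` on the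
  block lattice; NO `recordHr`, `recordGkL`, `recordResponse9DataFromL`, `recordD` is displayed.  Whether (L-dec) is S-wrap-hit or exempt = ★ P3's located question
  Q-P3-wrap (nodeO STATUS 2026-08-31T05:35:19Z) = whether `ΦfOf (recordTermsAx …)` is a gauge-INVARIANT functional of `B`; if exempt, exit (α) is needed for a PROOF
  of (L-dec) via propagator decay at most, never for the SHAPE of the door.
§7a keeps PTC-1's joint frame (`∃ γ₀ ε₂₉ C δ₁` once); §7b is the TWO-SUPPLIER frame (each half for all sufficiently small `ε₂₉`, its own `γ₀`; combined at
`ε₂₉ := min εL εD`, `γ₀ := min`), so that the (1.21) half and the decay half may come from DIFFERENT pens ∕ roads.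

HONEST FRAMING.  CONDITIONAL helpers; every hypothesis displayed is OPEN Bałaban-strength content ([I] (1.21), (4.37)∕(5.10)) or P0 at the record ((R-Uk), (R-Bg));
nothing of Bałaban is asserted, ported, discharged or refuted; Q-P3-wrap OPEN; K0ᴬ stmt-QuantumFields-27238 OPEN; 27931 CLOSED · IMPLICATION-ONLY · IN TOTO (№515);
27930 ∕ 26648 OPEN; NODE O not inhabited (0∕1); COUNT 8∕28 · K 1∕4 UNMOVED; finite `𝕋⁴_{L^K}` at fixed ε — NOT continuum ∕ ℝ⁴ ∕ OS; **the Yang–Mills mass gap (Clay)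
is NOT proved by any of this.**  No `sorry`, no new `def`, `instance`, `axiom`, `notation`; standard axioms only.
-/

noncomputable section

open scoped BigOperators Matrix.Norms.L2Operator Topology

namespace Summit.QuantumFields.YangMills.Theorems.K0AxJoinResidual

open Summit.QuantumFields.YangMills.Theorems.K0RecordFormatNames
open Summit.QuantumFields.YangMills.Theorems
open Summit.QuantumFields.YangMills.Theorems.PortHRecordJoin
open Literature.MathematicalPhysics.QuantumFieldTheory.Balaban1983to89
open Literature.MathematicalPhysics.QuantumFieldTheory.Balaban1983to89.Node00
open Literature.MathematicalPhysics.QuantumFieldTheory.Balaban1983to89.T4Continuum (T4Family)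
open Literature.MathematicalPhysics.QuantumFieldTheory.Balaban1983to89.FlowStep
open Literature.MathematicalPhysics.QuantumFieldTheory.Balaban1983to89.FlowStepRuns

/-! ## §7a  The limit-join from the (1.21) letter + the per-volume EVENTUAL (5.10) letter (joint frame) -/

/-- **`JoinConclLimR Tok F` from (L-lim) ∧ (L-dec) in ▶ PTC-1's joint frame**: under the JOIN antecedents at cofinally admissible cut-offs, `∃ γ₀ ε₂₉ C δ₁` with the (1.21)
letter AND the per-volume eventual (5.10) letter for the kernels `recordPvolAx … K 0 1` ⟹ the limit-join (decay passes to the volume limit: ✓`recordPlimDecayOnRunsAx_of_pvol`).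
[cite: Balaban1987RG1, (1.21)–(1.22) p.264, (4.37) p.291, (5.10) p.293, (0.20) p.256] -/
theorem joinConclLimR_of_polLimit_pvolDecayEv {Tok : T4Family → ℕ → ℝ → Prop} {F : T4Family}
    (h : ∃ Mth : ℕ, ∀ Mc : ℕ, Mth ≤ Mc → ∀ (j c c₀ c₁ : ℕ) (B₃ B₃' a₀ a₁ : ℝ), JoinAntecedents Tok F Mc j c c₀ c₁ B₃ B₃' a₀ a₁ →
      ∃ γ₀ ε₂₉ C δ₁ : ℝ, 0 < γ₀ ∧ 0 < ε₂₉ ∧ ∀ γ : ℝ, γ ≤ γ₀ →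
        (RecordPolLimitOnRunsAx F a₀ ε₂₉ γ ∧ RecordPvolDecayEvOnRunsAx F a₀ ε₂₉ γ C δ₁)) :
    JoinConclLimR Tok F := by
  obtain ⟨Mth, hM⟩ := h
  refine ⟨Mth, fun Mc hMc j c c₀ c₁ B₃ B₃' a₀ a₁ hA => ?_⟩
  obtain ⟨γ₀, ε₂₉, C, δ₁, hγ₀, hε, hh⟩ := hM Mc hMc j c c₀ c₁ B₃ B₃' a₀ a₁ hA
  exact ⟨γ₀, ε₂₉, C, δ₁, hγ₀, hε, fun γ hγ =>
    ⟨(hh γ hγ).1, recordPlimDecayOnRunsAx_of_pvol F a₀ ε₂₉ (hh γ hγ).1 (hh γ hγ).2⟩⟩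

/-- ★★★ **THE TOKEN-FREE DOOR, SPLIT (joint frame)**: `(∀ F, (L-lim) ∧ (L-dec) under the token-free JOIN antecedents)` ∧ (R-Uk) ∧ (R-Bg) ⟹ K0ᴬ BY NAME.  The ONLY single-volume
decaying object displayed is the kernel `recordPvolAx F a₀ ε₂₉ k (prefixOf gs k) K 0 1` (eventually in `K`, run-uniform `(C, δ₁)`).  CONDITIONAL helper; K0ᴬ OPEN; the mass gap is NOT proved.
[cite: Balaban1987RG1, Thm 1 p.259, Thm 3 p.264, (1.21)–(1.22) p.264, (4.37) p.291, (5.10) p.293; Balaban1985Variational, Thm 1 (8)–(9) p.279; Balaban1988Convergent, Thm 1 p.262] -/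
theorem record13SepCoPHInhabitedAx_of_polLimit_pvolDecayEv_tokFree
    (hLP : ∀ F : T4Family, ∃ Mth : ℕ, ∀ Mc : ℕ, Mth ≤ Mc → ∀ (j c c₀ c₁ : ℕ) (B₃ B₃' a₀ a₁ : ℝ), JoinAntecedents (fun _ _ _ => True) F Mc j c c₀ c₁ B₃ B₃' a₀ a₁ →
      ∃ γ₀ ε₂₉ C δ₁ : ℝ, 0 < γ₀ ∧ 0 < ε₂₉ ∧ ∀ γ : ℝ, γ ≤ γ₀ →
        (RecordPolLimitOnRunsAx F a₀ ε₂₉ γ ∧ RecordPvolDecayEvOnRunsAx F a₀ ε₂₉ γ C δ₁))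
    (hUk : ∀ F : T4Family, ∃ aU : ℝ, 0 < aU ∧ ∀ (B₃ a₀ a₁ : ℝ), 2 * (F.L : ℝ) ^ 2 ≤ B₃ → 0 < a₀ → a₀ ≤ aU → 0 < a₁ → ∃ M₀ : ℕ, ∀ Mc : ℕ, McGuard F Mc → M₀ ≤ Mc →
      (∀ ε₁ : ℝ, 0 < ε₁ → ε₁ ≤ a₁ → B₃ * ε₁ ≤ a₀ → ∀ (k n : ℕ) (V : Literature.MathematicalPhysics.QuantumFieldTheory.Balaban1983to89.GaugeField (F.P (Summit.QuantumFields.YangMills.Theorems.K0RecordFormatNames.recordK₀ F Mc k + n)) (k + 1) (Literature.MathematicalPhysics.QuantumFieldTheory.Balaban1983to89.Node00.SU 2)), Literature.MathematicalPhysics.QuantumFieldTheory.Balaban1983to89.PlaqSmall ε₁ V → Literature.MathematicalPhysics.QuantumFieldTheory.Balaban1983to89.Node00.UkExists F 2 (Summit.QuantumFields.YangMills.Theorems.K0RecordFormatNames.recordK₀ F Mc k + n) (k + 1) a₀ V ∧ Literature.MathematicalPhysics.QuantumFieldTheory.Balaban1983to89.Node00.UniqueUkOrbit F 2 (Summit.QuantumFields.YangMills.Theorems.K0RecordFormatNames.recordK₀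 F Mc k + n) (k + 1) a₀ V))
    (hBg : ∀ F : T4Family, ∃ aB : ℝ, 0 < aB ∧ ∀ a₀ : ℝ, 0 < a₀ → a₀ ≤ aB → ∃ M₀ : ℕ, ∀ Mc : ℕ, McGuard F Mc → M₀ ≤ Mc →
      (∀ (k n : ℕ) (ε₂₉ : ℝ), 0 < ε₂₉ → letI θ := Summit.QuantumFields.YangMills.Theorems.K0RecordFormatNames.thetaFill F a₀ ε₂₉; letI := θ.instVβ₁; letI := θ.instVβ₂; letI := θ.instιβ; AnalyticAt ℝ (fun B : Summit.QuantumFields.YangMills.Theorems.K0RecordFormatNames.recordW F a₀ ε₂₉ k (Summit.QuantumFields.YangMills.Theorems.K0RecordFormatNames.recordK₀ F Mc k + n) => fun (b : Literature.MathematicalPhysics.QuantumFieldTheory.Balaban1983to89.PBond (F.P (Summit.QuantumFields.YangMills.Theorems.K0RecordFormatNames.recordK₀ F Mc k + n)) 0) (i i' : Fin 2) => ((Summit.QuantumFields.YangMills.Theorems.K0RecordFormatNames.recordBgField F θ k (Summit.QuantumFields.YangMills.Theorems.K0RecordFormatNames.recordK₀ F Mc k + n) B b : Literature.MathematicalPhysics.QuantumFieldTheory.Balaban1983to89.Node00.SU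 2) : Matrix (Fin 2) (Fin 2) ℂ) i i') 0)) :
    Summit.QuantumFields.YangMills.Theses.BalabanUVNodes.Record13SepCoPHInhabitedAx :=
  record13SepCoPHInhabitedAx_of_lim_residual_tokFree (fun F => joinConclLimR_of_polLimit_pvolDecayEv (hLP F)) hUk hBg

/-! ## §7b  The TWO-SUPPLIER frame: the (1.21) half and the decay half from different roads, each for all sufficiently small `ε₂₉` -/

/-- **`JoinConclLimR Tok F` from TWO SUPPLIERS**: (L-lim)′ «under the JOIN antecedents, ∃ εL > 0, ∀ ε₂₉ ∈ ]0, εL], ∃ γ₀ > 0, ∀ γ ≤ γ₀, the (1.21) letter» and (L-dec)′ «…, ∃ εD > 0,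
∀ ε₂₉ ∈ ]0, εD], ∃ γ₀ C δ₁, 0 < γ₀ ∧ ∀ γ ≤ γ₀, the per-volume eventual (5.10) letter» ⟹ the limit-join, at `ε₂₉ := min εL εD`, `γ₀ := min γ₀ᴸ γ₀ᴰ`, `Mth := max`.
[cite: Balaban1987RG1, (1.21)–(1.22) p.264, (2.9) p.266, (4.37) p.291, (5.10) p.293] -/
theorem joinConclLimR_of_polLimit_and_pvolDecayEv {Tok : T4Family → ℕ → ℝ → Prop} {F : T4Family}
    (hLim : ∃ Mth : ℕ, ∀ Mc : ℕ, Mth ≤ Mc → ∀ (j c c₀ c₁ : ℕ) (B₃ B₃' a₀ a₁ : ℝ), JoinAntecedents Tok F Mc j c c₀ c₁ B₃ B₃' a₀ a₁ →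
      ∃ εL : ℝ, 0 < εL ∧ ∀ ε₂₉ : ℝ, 0 < ε₂₉ → ε₂₉ ≤ εL → ∃ γ₀ : ℝ, 0 < γ₀ ∧ ∀ γ : ℝ, γ ≤ γ₀ → RecordPolLimitOnRunsAx F a₀ ε₂₉ γ)
    (hDec : ∃ Mth : ℕ, ∀ Mc : ℕ, Mth ≤ Mc → ∀ (j c c₀ c₁ : ℕ) (B₃ B₃' a₀ a₁ : ℝ), JoinAntecedents Tok F Mc j c c₀ c₁ B₃ B₃' a₀ a₁ →
      ∃ εD : ℝ, 0 < εD ∧ ∀ ε₂₉ : ℝ, 0 < ε₂₉ → ε₂₉ ≤ εD → ∃ γ₀ C δ₁ : ℝ, 0 < γ₀ ∧ ∀ γ : ℝ, γ ≤ γ₀ → RecordPvolDecayEvOnRunsAx F a₀ ε₂₉ γ C δ₁) :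
    JoinConclLimR Tok F := by
  obtain ⟨MthL, hL⟩ := hLim
  obtain ⟨MthD, hD⟩ := hDec
  refine ⟨max MthL MthD, fun Mc hMc j c c₀ c₁ B₃ B₃' a₀ a₁ hA => ?_⟩
  obtain ⟨εL, hεL, hL'⟩ := hL Mc (le_trans (le_max_left _ _) hMc) j c c₀ c₁ B₃ B₃' a₀ a₁ hA
  obtain ⟨εD, hεD, hD'⟩ := hD Mc (le_trans (le_max_right _ _) hMc) j c c₀ c₁ B₃ B₃' a₀ a₁ hA
  obtain ⟨γL, hγL, hLγ⟩ := hL' (min εL εD) (lt_min hεL hεD) (min_le_left _ _)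
  obtain ⟨γD, C, δ₁, hγD, hDγ⟩ := hD' (min εL εD) (lt_min hεL hεD) (min_le_right _ _)
  refine ⟨min γL γD, min εL εD, C, δ₁, lt_min hγL hγD, lt_min hεL hεD, fun γ hγ => ?_⟩
  have hlim := hLγ γ (le_trans hγ (min_le_left _ _))
  exact ⟨hlim, recordPlimDecayOnRunsAx_of_pvol F a₀ (min εL εD) hlim (hDγ γ (le_trans hγ (min_le_right _ _)))⟩

/-- ★★★ **THE TOKEN-FREE DOOR FROM TWO SUPPLIERS**: (L-lim)′ [the (1.21) half — two-volume ∕ Cauchy road, S-wrap-exempt] ∧ (L-dec)′ [per-volume eventual decay of the kernel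
`recordPvolAx … K 0 1`, run-uniform constants — S-wrap status = Q-P3-wrap] ∧ (R-Uk) ∧ (R-Bg) ⟹ K0ᴬ BY NAME.  CONDITIONAL helper; K0ᴬ OPEN; the mass gap is NOT proved.
[cite: Balaban1987RG1, Thm 1 p.259, Thm 3 p.264, (1.21)–(1.22) p.264, (4.37) p.291, (5.10) p.293; Balaban1985Variational, Thm 1 (8)–(9) p.279; Balaban1988Convergent, Thm 1 p.262] -/
theorem record13SepCoPHInhabitedAx_of_twoSuppliers_tokFree
    (hLim : ∀ F : T4Family, ∃ Mth : ℕ, ∀ Mc : ℕ, Mth ≤ Mc → ∀ (j c c₀ c₁ : ℕ) (B₃ B₃' a₀ a₁ : ℝ), JoinAntecedents (fun _ _ _ => True) F Mc j c c₀ c₁ B₃ B₃' a₀ a₁ →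
      ∃ εL : ℝ, 0 < εL ∧ ∀ ε₂₉ : ℝ, 0 < ε₂₉ → ε₂₉ ≤ εL → ∃ γ₀ : ℝ, 0 < γ₀ ∧ ∀ γ : ℝ, γ ≤ γ₀ → RecordPolLimitOnRunsAx F a₀ ε₂₉ γ)
    (hDec : ∀ F : T4Family, ∃ Mth : ℕ, ∀ Mc : ℕ, Mth ≤ Mc → ∀ (j c c₀ c₁ : ℕ) (B₃ B₃' a₀ a₁ : ℝ), JoinAntecedents (fun _ _ _ => True) F Mc j c c₀ c₁ B₃ B₃' a₀ a₁ →
      ∃ εD : ℝ, 0 < εD ∧ ∀ ε₂₉ : ℝ, 0 < ε₂₉ → ε₂₉ ≤ εD → ∃ γ₀ C δ₁ : ℝ, 0 < γ₀ ∧ ∀ γ : ℝ, γ ≤ γ₀ → RecordPvolDecayEvOnRunsAx F a₀ ε₂₉ γ C δ₁)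
    (hUk : ∀ F : T4Family, ∃ aU : ℝ, 0 < aU ∧ ∀ (B₃ a₀ a₁ : ℝ), 2 * (F.L : ℝ) ^ 2 ≤ B₃ → 0 < a₀ → a₀ ≤ aU → 0 < a₁ → ∃ M₀ : ℕ, ∀ Mc : ℕ, McGuard F Mc → M₀ ≤ Mc →
      (∀ ε₁ : ℝ, 0 < ε₁ → ε₁ ≤ a₁ → B₃ * ε₁ ≤ a₀ → ∀ (k n : ℕ) (V : Literature.MathematicalPhysics.QuantumFieldTheory.Balaban1983to89.GaugeField (F.P (Summit.QuantumFields.YangMills.Theorems.K0RecordFormatNames.recordK₀ F Mc k + n)) (k + 1) (Literature.MathematicalPhysics.QuantumFieldTheory.Balaban1983to89.Node00.SU 2)), Literature.MathematicalPhysics.QuantumFieldTheory.Balaban1983to89.PlaqSmall ε₁ V → Literature.MathematicalPhysics.QuantumFieldTheory.Balaban1983to89.Node00.UkExists F 2 (Summit.QuantumFields.YangMills.Theorems.K0RecordFormatNames.recordK₀ F Mc k + n) (k + 1) a₀ V ∧ Literature.MathematicalPhysics.QuantumFieldTheory.Balaban1983to89.Node00.UniqueUkOrbit F 2 (Summit.QuantumFields.YangMills.Theorems.K0RecordFormatNames.recordK₀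 F Mc k + n) (k + 1) a₀ V))
    (hBg : ∀ F : T4Family, ∃ aB : ℝ, 0 < aB ∧ ∀ a₀ : ℝ, 0 < a₀ → a₀ ≤ aB → ∃ M₀ : ℕ, ∀ Mc : ℕ, McGuard F Mc → M₀ ≤ Mc →
      (∀ (k n : ℕ) (ε₂₉ : ℝ), 0 < ε₂₉ → letI θ := Summit.QuantumFields.YangMills.Theorems.K0RecordFormatNames.thetaFill F a₀ ε₂₉; letI := θ.instVβ₁; letI := θ.instVβ₂; letI := θ.instιβ; AnalyticAt ℝ (fun B : Summit.QuantumFields.YangMills.Theorems.K0RecordFormatNames.recordW F a₀ ε₂₉ k (Summit.QuantumFields.YangMills.Theorems.K0RecordFormatNames.recordK₀ F Mc k + n) => fun (b : Literature.MathematicalPhysics.QuantumFieldTheory.Balaban1983to89.PBond (F.P (Summit.QuantumFields.YangMills.Theorems.K0RecordFormatNames.recordK₀ F Mc k + n)) 0) (i i' : Fin 2) => ((Summit.QuantumFields.YangMills.Theorems.K0RecordFormatNames.recordBgField F θ k (Summit.QuantumFields.YangMills.Theorems.K0RecordFormatNames.recordK₀ F Mc k + n) B b : Literature.MathematicalPhysics.QuantumFieldTheory.Balaban1983to89.Node00.SU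 2) : Matrix (Fin 2) (Fin 2) ℂ) i i') 0)) :
    Summit.QuantumFields.YangMills.Theses.BalabanUVNodes.Record13SepCoPHInhabitedAx :=
  record13SepCoPHInhabitedAx_of_lim_residual_tokFree (fun F => joinConclLimR_of_polLimit_and_pvolDecayEv (hLim F) (hDec F)) hUk hBg

/-- ★★ **… and token-parametric** (any cut `Tok`, with (R-Tok) displayed): (L-lim)′ ∧ (L-dec)′ under `JoinAntecedents Tok` ∧ (R-Uk) ∧ (R-Bg) ∧ (R-Tok) ⟹ K0ᴬ BY NAME.
[cite: Balaban1987RG1, Thm 1 p.259, (1.21)–(1.22) p.264, (5.10) p.293; Balaban1985Variational, Prop. 9 p.309] -/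
theorem record13SepCoPHInhabitedAx_of_twoSuppliers_residual (Tok : T4Family → ℕ → ℝ → Prop)
    (hLim : ∀ F : T4Family, ∃ Mth : ℕ, ∀ Mc : ℕ, Mth ≤ Mc → ∀ (j c c₀ c₁ : ℕ) (B₃ B₃' a₀ a₁ : ℝ), JoinAntecedents Tok F Mc j c c₀ c₁ B₃ B₃' a₀ a₁ →
      ∃ εL : ℝ, 0 < εL ∧ ∀ ε₂₉ : ℝ, 0 < ε₂₉ → ε₂₉ ≤ εL → ∃ γ₀ : ℝ, 0 < γ₀ ∧ ∀ γ : ℝ, γ ≤ γ₀ → RecordPolLimitOnRunsAx F a₀ ε₂₉ γ)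
    (hDec : ∀ F : T4Family, ∃ Mth : ℕ, ∀ Mc : ℕ, Mth ≤ Mc → ∀ (j c c₀ c₁ : ℕ) (B₃ B₃' a₀ a₁ : ℝ), JoinAntecedents Tok F Mc j c c₀ c₁ B₃ B₃' a₀ a₁ →
      ∃ εD : ℝ, 0 < εD ∧ ∀ ε₂₉ : ℝ, 0 < ε₂₉ → ε₂₉ ≤ εD → ∃ γ₀ C δ₁ : ℝ, 0 < γ₀ ∧ ∀ γ : ℝ, γ ≤ γ₀ → RecordPvolDecayEvOnRunsAx F a₀ ε₂₉ γ C δ₁)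
    (hUk : ∀ F : T4Family, ∃ aU : ℝ, 0 < aU ∧ ∀ (B₃ a₀ a₁ : ℝ), 2 * (F.L : ℝ) ^ 2 ≤ B₃ → 0 < a₀ → a₀ ≤ aU → 0 < a₁ → ∃ M₀ : ℕ, ∀ Mc : ℕ, McGuard F Mc → M₀ ≤ Mc →
      (∀ ε₁ : ℝ, 0 < ε₁ → ε₁ ≤ a₁ → B₃ * ε₁ ≤ a₀ → ∀ (k n : ℕ) (V : Literature.MathematicalPhysics.QuantumFieldTheory.Balaban1983to89.GaugeField (F.P (Summit.QuantumFields.YangMills.Theorems.K0RecordFormatNames.recordK₀ F Mc k + n)) (k + 1) (Literature.MathematicalPhysics.QuantumFieldTheory.Balaban1983to89.Node00.SU 2)), Literature.MathematicalPhysics.QuantumFieldTheory.Balaban1983to89.PlaqSmall ε₁ V → Literature.MathematicalPhysics.QuantumFieldTheory.Balaban1983to89.Node00.UkExists F 2 (Summit.QuantumFields.YangMills.Theorems.K0RecordFormatNames.recordK₀ F Mc k + n) (k + 1) a₀ V ∧ Literature.MathematicalPhysics.QuantumFieldTheory.Balaban1983to89.Node00.UniqueUkOrbit F 2 (Summit.QuantumFields.YangMills.Theorems.K0RecordFormatNames.recordK₀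 F Mc k + n) (k + 1) a₀ V))
    (hBg : ∀ F : T4Family, ∃ aB : ℝ, 0 < aB ∧ ∀ a₀ : ℝ, 0 < a₀ → a₀ ≤ aB → ∃ M₀ : ℕ, ∀ Mc : ℕ, McGuard F Mc → M₀ ≤ Mc →
      (∀ (k n : ℕ) (ε₂₉ : ℝ), 0 < ε₂₉ → letI θ := Summit.QuantumFields.YangMills.Theorems.K0RecordFormatNames.thetaFill F a₀ ε₂₉; letI := θ.instVβ₁; letI := θ.instVβ₂; letI := θ.instιβ; AnalyticAt ℝ (fun B : Summit.QuantumFields.YangMills.Theorems.K0RecordFormatNames.recordW F a₀ ε₂₉ k (Summit.QuantumFields.YangMills.Theorems.K0RecordFormatNames.recordK₀ F Mc k + n) => fun (b : Literature.MathematicalPhysics.QuantumFieldTheory.Balaban1983to89.PBond (F.P (Summit.QuantumFields.YangMills.Theorems.K0RecordFormatNames.recordK₀ F Mc k + n)) 0) (i i' : Fin 2) => ((Summit.QuantumFields.YangMills.Theorems.K0RecordFormatNames.recordBgField F θ k (Summit.QuantumFields.YangMills.Theorems.K0RecordFormatNames.recordK₀ F Mc k + n) B b : Literature.MathematicalPhysics.QuantumFieldTheory.Balaban1983to89.Node00.SU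 2) : Matrix (Fin 2) (Fin 2) ℂ) i i') 0))
    (hTok : ∀ F : T4Family, ∃ aT : ℝ, 0 < aT ∧ ∀ a₀ : ℝ, 0 < a₀ → a₀ ≤ aT → ∃ M₀ : ℕ, ∀ Mc : ℕ, McGuard F Mc → M₀ ≤ Mc → Tok F Mc a₀) :
    Summit.QuantumFields.YangMills.Theses.BalabanUVNodes.Record13SepCoPHInhabitedAx :=
  record13SepCoPHInhabitedAx_of_lim_residual Tok (fun F => joinConclLimR_of_polLimit_and_pvolDecayEv (hLim F) (hDec F)) hUk hBg hTok

end Summit.QuantumFields.YangMills.Theorems.K0AxJoinResidual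

end
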